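import Summits.Ventures.HodgeRepro.Night1AndreReduction

/-!
# S3 (André 1992 / Milne 2020 Theorem 1) on the kernel, II: `f_Δ^*` is Galois-equivariant — the pulled-back
Weil spaces and the space of Hodge classes of `A` are Galois-stable

Blind re-derivation cell `pub-hodge-repro`, seat `night-1` (gen 6).  Imports night-1's
`Night1AndreReduction` (the push-forward `pushMap`, André's map `andreMap Δ : Δ × G → X`, `(s, t) ↦ t • s`,
the pull-back `andrePull Δ (2p) = ⋀^{2p} (pushMap (andreMap Δ))` of the Weil space of the corner product
`A_Δ = ∏_{s∈Δ} A_s` along the diagonal, the wedges `e_{σ • Δ}` (`deltaEnum`) and Theorem 1 complexified,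
`jointEigenspaceOn_eq_iSup_map_andrePull`).  Namespace `HodgeRepro.RouteC`.

Milne 2020 (store `paper:arxiv-2010.08857`) p0005:L34–45 defines `f_Δ` as a HOMOMORPHISM of abelian
varieties, so `f_Δ^*` is a morphism of `ℚ`-Hodge structures; on the model, where the rational structure is
carried by the Galois action on the embedding coordinates (night-1's `galProd` on `⋀^{2p} ℂ^{Δ × G}`,
here `galOn` on `⋀^{2p} ℂ^X`: `e_x ↦ e_{g • x}`), this is the identity `(g t) • s = g • (t • s)`:

* `galOnLin g` / `galOn p g` — the Galois action of `g ∈ G` on `ℂ^X` and on `⋀^{2p} ℂ^X`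
  (`galOnLin_coordVecOn`, `galOn_coordWedgeOn_deltaEnum`: `g` carries `e_{σ • Δ}` to `e_{(gσ) • Δ}`);
* **`pushMap_andreMap_comp_galProdLin`** / **`andrePull_comp_galProd`** — `f_Δ^* ∘ galProd p g =
  galOn p g ∘ f_Δ^*` on `H¹` and on `H^{2p}`;
* **`map_galOn_map_andrePull_weilSpaceProd`** — the pulled-back Weil space `f_Δ^*(W_F(A_Δ)) ⊗ ℂ` is
  Galois-stable (`g` permutes the orbit `{e_{σ • Δ}}`);
* **`map_galOn_jointEigenspaceOn_eq`** — through Theorem 1, the whole space of Hodge classes of `A`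
  (typer-2's joint `(p, p)`-eigenspace of the conjugate cocharacters `μ_{g • Φ}`) is Galois-stable.

Nothing geometric is built; every statement is about coordinate wedges on finite `G`-sets.  Nothing here
says anything about the status of the Hodge conjecture for CM abelian varieties, which is NOT proved.
-/

set_option autoImplicit false

open Finset Module
open scoped Pointwise

namespace HodgeRepro.RouteC

open CMHodgeOn

/-! ### Galois equivariance: `f_Δ^*` intertwines the model's Galois actions -/

section Galois

variable {G : Type*} [Group G] [DecidableEq G] [Fintype G] {X : Type*} [MulAction G X] [Fintype X]
  [DecidableEq X]

/-- The Galois action of `g ∈ G` on `ℂ^X`: the coordinate permutation `e_x ↦ e_{g • x}` (the analogue on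
the `G`-set `X` of night-1's `galProdLin` on `ι × G`). -/
def galOnLin (g : G) : (X → ℂ) →ₗ[ℂ] (X → ℂ) :=
  LinearMap.funLeft ℂ ℂ fun x : X => g⁻¹ • x

omit [DecidableEq G] [Fintype G] [Fintype X] in
/-- `g` carries the coordinate vector of `x` to that of `g • x`. -/
theorem galOnLin_coordVecOn (g : G) (x : X) : galOnLin g (coordVecOn x) = coordVecOn (g • x) := by
  funext y
  simp only [galOnLin, LinearMap.funLeft_apply, coordVecOn_apply]
  have hiff : g⁻¹ • y = x ↔ y = g • x := by
    constructor
    · rintro rfl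
      simp
    · rintro rfl
      simp
  rw [if_congr hiff rfl rfl]

omit [Fintype X] in
/-- **`f_Δ^*` on `H¹` is Galois-equivariant**: the push-forward along André's map intertwines the action
`(s, t) ↦ (s, g t)` on `ℂ^{Δ × G}` with the action `x ↦ g • x` on `ℂ^X` (`(g t) • s = g • (t • s)`). -/
theorem pushMap_andreMap_comp_galProdLin (Δ : Finset X) (g : G) :
    pushMap (andreMap Δ) ∘ₗ galProdLin g = galOnLin g ∘ₗ pushMap (andreMap Δ) := by
  refine (Pi.basisFun ℂ (↥Δ × G)).ext fun q => ?_
  simp only [Pi.basisFun_apply, LinearMap.comp_apply]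
  change pushMap (andreMap Δ) (galProdLin g (coordVecOn q)) =
    galOnLin g (pushMap (andreMap Δ) (coordVecOn q))
  rw [galProdLin_coordVecOn, pushMap_coordVecOn, pushMap_coordVecOn, galOnLin_coordVecOn]
  simp only [andreMap, mul_smul]

/-- The Galois action of `g ∈ G` on `⋀^{2p} ℂ^X`. -/
noncomputable def galOn (p : ℕ) (g : G) : ⋀[ℂ]^(2 * p) (X → ℂ) →ₗ[ℂ] ⋀[ℂ]^(2 * p) (X → ℂ) :=
  exteriorPower.map (2 * p) (galOnLin g)

omit [Fintype X] in
/-- **`f_Δ^*` on `H^{2p}` is Galois-equivariant**: `f_Δ^* ∘ galProd p g = galOn p g ∘ f_Δ^*`. -/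
theorem andrePull_comp_galProd (Δ : Finset X) (p : ℕ) (g : G) :
    andrePull Δ (2 * p) ∘ₗ galProd p g = galOn p g ∘ₗ andrePull Δ (2 * p) := by
  unfold andrePull galProd galOn
  rw [← exteriorPower.map_comp, ← exteriorPower.map_comp, pushMap_andreMap_comp_galProdLin]

omit [DecidableEq G] [Fintype G] [Fintype X] in
/-- `g` carries the wedge `e_{σ • Δ}` to `e_{(gσ) • Δ}`. -/
theorem galOn_coordWedgeOn_deltaEnum {p : ℕ} (Δ : Finset X) (e : Fin (2 * p) ≃ ↥Δ) (g σ : G) :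
    galOn p g (coordWedgeOn (2 * p) (deltaEnum Δ e σ)) = coordWedgeOn (2 * p) (deltaEnum Δ e (g * σ)) := by
  unfold galOn coordWedgeOn
  rw [exteriorPower.map_apply_ιMulti]
  congr 1
  funext j
  rw [Function.comp_apply, galOnLin_coordVecOn]
  simp only [deltaEnum, mul_smul]

omit [Fintype X] in
/-- **The pulled-back Weil space is Galois-stable**: `g` permutes the wedges of the orbit
`{e_{σ • Δ}}`. -/
theorem map_galOn_map_andrePull_weilSpaceProd {p : ℕ} (Δ : Finset X) (e : Fin (2 * p) ≃ ↥Δ) (g : G) :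
    ((weilSpaceProd G p e).map (andrePull Δ (2 * p))).map (galOn p g) =
      (weilSpaceProd G p e).map (andrePull Δ (2 * p)) := by
  rw [← Submodule.map_comp, ← andrePull_comp_galProd, Submodule.map_comp, map_galProd_weilSpaceProd]

/-- **The Hodge classes of `A` are Galois-stable** (through Theorem 1: each pulled-back Weil space is):
`galOn p g` maps the joint `(p, p)`-eigenspace of the conjugate cocharacters onto itself. -/
theorem map_galOn_jointEigenspaceOn_eq {c : G} (hc : IsComplexConj c) {Φ : Finset X}
    (hΦ : IsCMTypeOn c Φ) (p : ℕ) (g : G) :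
    (jointEigenspaceOn (fun g : G => g • Φ) (2 * p) p).map (galOn p g) =
      jointEigenspaceOn (fun g : G => g • Φ) (2 * p) p := by
  rw [jointEigenspaceOn_eq_iSup_map_andrePull hc hΦ p]
  simp only [Submodule.map_iSup, map_galOn_map_andrePull_weilSpaceProd]

end Galois

end HodgeRepro.RouteC
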